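import Mathlib.Tactic
import HarnessLib

/-!
# Kozma–Nitzan's Question 8 — the δ-recursion and THEOREM R(δ): DICHOTOMY D reduced to UNI(δ;y) (gen 43)

Support file (`--supports stmt-CriticalPhenomena-4575`, closed crux; independent mathematics on Kozma–Nitzan's Question 8,
arXiv:2401.12397 §5.5 p. 36), prover `prim-ineq-gen-6` (gen 43).  No definitions, no named facts, no sorries; standard axioms.
Memo `run/shared/lean/prim/prim-ineq-gen-6/PROOF-DRED-G43.md`.

The two-level subtree balance `δ` (level-0 money `ψ = y + β` plus the level-1 cascade surplus `w⁺`) of the path-end block satisfies the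
exact class-level recursion `δ_j = max(U_j, Λ_j)`, `Λ_j = ψ_j + Σ_{i<j} r_{i,j} δ_i` (`U` = the one-level lumped balance, `Λ_j − U_j = −w_j`).
Consequences recorded here as algebraic / order kernels over `ℝ`:

* `dR_max_of_cascade` — `δ = U + w⁻` and `Λ = U − w` give `δ = max(U, Λ)`;
* `dR_importer_iff` — an importer (`δ_t < β_t`) is exactly a node with `U_t < β_t` and `Λ_t < β_t`, i.e. `x_t + y_t + p_tQ^U_t < 0` and `y_t + p_tQ^δ_t < 0`
  (so importers are `(δ;y)`-importers and UNI(δ;y) at importers gives (X1));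
* `dR_kill_min` — at a nonpositive class the δ-kill is the smaller of the U-kill and the Λ-kill: `−δ = min(−U, −Λ)`;
* `dR_family_step` — the down-set family `F^S` (x kept on a down-set) is dominated by `δ` (one induction step);
* `dR_partialSums_antitone` — under SSC the cumulative emission sums are non-increasing beyond the sign change (hypothesis monotonicity,
  first-importer reduction);
* `dR_thmR_chain` — THEOREM R as an induction over the vertices: the one-step identity for `V_t = ℛ_t + y_t/p_t` with nonnegative brackets
  `Q_{t−1} + cγ_{t−1} ≥ 0` ((Q-A) at every depth) gives `V_T ≥ 0`, i.e. UNI-A(δ;y)(T) — valid for ANY children balance vector, in particular `δ`;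
* `dR_chebyshev_CK` — the cap-free Chebyshev reduction (Q-A)(δ)_d ⟸ CK(δ)_d: with sign-ordered emissions and `θ ≤ θ*` on the negative ones,
  `Σ θ_k g_k ≥ −Σ_{positives} (θ* − θ_k)⁺ g_k` whenever `Σ g_k > 0`.
[cite: KozmaNitzan2024, Question 8 (§5.5 p. 36)]
-/

namespace Summit.CriticalPhenomena.PercolationContinuityZ3.Theorems

namespace PocketCert

open Finset

/-- **The δ-recursion from the cascade bookkeeping.**  If `Λ = U − w` and `δ = U + w⁻` (`w⁻ = max(−w,0)`), then `δ = max(U, Λ)`.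
[cite: KozmaNitzan2024, Question 8 (§5.5 p. 36)] -/
theorem dR_max_of_cascade (U Λ δ w : ℝ) (hΛ : Λ = U - w) (hδ : δ = U + max (-w) 0) : δ = max U Λ := by
  rw [hδ, hΛ]
  rcases le_total w 0 with hw | hw
  · rw [max_eq_left (by linarith), max_eq_right (by linarith)]; ring
  · rw [max_eq_right (by linarith), max_eq_left (by linarith)]; ring

/-- **Importer characterisation.**  With `δ = max(U, Λ)`: `δ < β ↔ (U < β ∧ Λ < β)`.  Reading `U − β = x + y + pQ^U` and `Λ − β = y + pQ^δ`,
an importer is a node whose children are in net deficit beyond `x_t + y_t` in the lumped accounting AND beyond `y_t` in the two-level accounting.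
[cite: KozmaNitzan2024, Question 8 (§5.5 p. 36)] -/
theorem dR_importer_iff (U Λ δ β : ℝ) (hδ : δ = max U Λ) : δ < β ↔ (U < β ∧ Λ < β) := by
  rw [hδ]; exact max_lt_iff

/-- **Importers are (δ;y)-importers.**  If `Λ = y + β + pQ` (`pQ = p_t·Q^δ_t`, the children's total) and `δ = max(U,Λ) < β`, then `y + pQ < 0`;
hence UNI-A(δ;y)(t), `pX ≤ (y + pQ)⁺`, forces `pX ≤ 0` ((X1) at the importer).
[cite: KozmaNitzan2024, Question 8 (§5.5 p. 36)] -/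
theorem dR_X1_of_uni (U Λ δ β y pQ pX : ℝ) (hδ : δ = max U Λ) (hΛ : Λ = y + β + pQ) (himp : δ < β)
    (huni : pX ≤ max (y + pQ) 0) : pX ≤ 0 := by
  have h1 : Λ < β := ((dR_importer_iff U Λ δ β hδ).1 himp).2
  have h2 : y + pQ < 0 := by linarith
  rwa [max_eq_right h2.le] at huni

/-- **δ-kills.**  At a class with `δ = max(U,Λ)`: `−δ = min(−U, −Λ)` — the two-level kill is the smaller of the lumped kill `|U|` and the
ψ-driven kill `|Λ| = −ψ − pQ^δ` (level-1 deficits do not absorb level-0 surplus).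
[cite: KozmaNitzan2024, Question 8 (§5.5 p. 36)] -/
theorem dR_kill_min (U Λ δ : ℝ) (hδ : δ = max U Λ) : -δ = min (-U) (-Λ) := by
  rw [hδ]
  rcases le_total U Λ with h | h
  · rw [max_eq_right h, min_eq_right (neg_le_neg h)]
  · rw [max_eq_left h, min_eq_left (neg_le_neg h)]

/-- **The down-set family is dominated by δ (induction step).**  Children values `f_i ≤ δ_i` with weights `r_i ≥ 0`; a new value which is either the
lumped balance `U` (class kept with its whole subtree) or `ψ + Σ r_i f_i` (own `x` stripped) is at most `δ = max(U, ψ + Σ r_i δ_i)`.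
[cite: KozmaNitzan2024, Question 8 (§5.5 p. 36)] -/
theorem dR_family_step (j : ℕ) (r f δc : ℕ → ℝ) (U ψ fj δj : ℝ)
    (hr : ∀ i < j, 0 ≤ r i) (hf : ∀ i < j, f i ≤ δc i)
    (hδ : δj = max U (ψ + ∑ i ∈ range j, r i * δc i))
    (hnew : fj = U ∨ fj = ψ + ∑ i ∈ range j, r i * f i) : fj ≤ δj := by
  rw [hδ]
  rcases hnew with h | h
  · rw [h]; exact le_max_left _ _
  · rw [h]
    apply le_trans _ (le_max_right _ _)
    have : ∑ i ∈ range j, r i * f i ≤ ∑ i ∈ range j, r i * δc i := by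
      apply sum_le_sum
      intro i hi
      exact mul_le_mul_of_nonneg_left (hf i (mem_range.mp hi)) (hr i (mem_range.mp hi))
    linarith

/-- **Hypothesis monotonicity / first-importer reduction.**  If the emissions are nonpositive from index `k₁` on (SSC), the partial sums
`S_d = Σ_{k ≤ d} g_k` are non-increasing in `d` on `d ≥ e ≥ k₁ − 1`: a positive A-corner sum at a node forces positive sums at every
earlier depth, and (X1) at the first importer gives (X1) at every later one.
[cite: KozmaNitzan2024, Question 8 (§5.5 p. 36)] -/
theorem dR_partialSums_antitone (g : ℕ → ℝ) (k₁ : ℕ) (hneg : ∀ k, k₁ ≤ k → g k ≤ 0) :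
    ∀ d e : ℕ, k₁ ≤ e + 1 → e ≤ d → ∑ k ∈ range (d + 1), g k ≤ ∑ k ∈ range (e + 1), g k := by
  intro d
  induction d with
  | zero =>
    intro e _ hed
    have : e = 0 := Nat.le_zero.mp hed
    subst this; exact le_refl _
  | succ d ih =>
    intro e he hed
    rcases Nat.eq_or_lt_of_le hed with h | h
    · subst h; exact le_refl _
    · have h1 : ∑ k ∈ range (d + 1), g k ≤ ∑ k ∈ range (e + 1), g k := ih e he (Nat.lt_succ_iff.mp h)
      have h2 : g (d + 1) ≤ 0 := hneg (d + 1) (by omega)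
      rw [sum_range_succ]
      linarith

/-- **THEOREM R(δ) as a chain.**  Let `V_0 ≥ 0` and, for every vertex `t`,
`V_{t+1} = A_{t+1}C_{t+1}V_t + c·a_{t+1}(1−C_{t+1}) + (1−A_{t+1})C_{t+1}(Q_t + cγ_t)` (the exact one-step identity for `V = ℛ^δ + y/p`,
`Q_t = γ_t·Qa^δ_t`), with marks in `[0,1]`, `a ≥ 0`, `c ≥ 0`.  If the corner condition (Q-A)(δ) holds at every depth below `T`
(`Q_t + cγ_t ≥ 0` for `t < T`), then `V_T ≥ 0`, i.e. UNI-A(δ;y) at node `T`.  (Mirror statement for `W = ℒ^δ + y/p` by symmetry.)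
[cite: KozmaNitzan2024, Question 8 (§5.5 p. 36)] -/
theorem dR_thmR_chain (A C a γ Q V : ℕ → ℝ) (c : ℝ) (hc : 0 ≤ c)
    (hA : ∀ t, 0 ≤ A t ∧ A t ≤ 1) (hC : ∀ t, 0 ≤ C t ∧ C t ≤ 1) (ha : ∀ t, 0 ≤ a t) (h0 : 0 ≤ V 0)
    (hrec : ∀ t, V (t + 1) = A (t + 1) * C (t + 1) * V t + c * a (t + 1) * (1 - C (t + 1))
                              + (1 - A (t + 1)) * C (t + 1) * (Q t + c * γ t)) :
    ∀ T : ℕ, (∀ t < T, 0 ≤ Q t + c * γ t) → 0 ≤ V T := by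
  intro T
  induction T with
  | zero => intro _; exact h0
  | succ T ih =>
    intro hQ
    have hV : 0 ≤ V T := ih (fun t ht => hQ t (Nat.lt_succ_of_lt ht))
    have hQT : 0 ≤ Q T + c * γ T := hQ T (Nat.lt_succ_self T)
    rw [hrec T]
    have h1 : 0 ≤ A (T + 1) * C (T + 1) * V T := mul_nonneg (mul_nonneg (hA _).1 (hC _).1) hV
    have h2 : 0 ≤ c * a (T + 1) * (1 - C (T + 1)) := mul_nonneg (mul_nonneg hc (ha _)) (sub_nonneg.2 (hC _).2)
    have h3 : 0 ≤ (1 - A (T + 1)) * C (T + 1) * (Q T + c * γ T) :=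
      mul_nonneg (mul_nonneg (sub_nonneg.2 (hA _).2) (hC _).1) hQT
    linarith

/-- **Cap-free Chebyshev reduction (Q-A)(δ) ⟸ CK(δ).**  Positive emissions `gp_i ≥ 0` (the classes `i < k₁`) with ratios `θp_i`, nonpositive
emissions `gn_k ≤ 0` with ratios `θn_k ≤ θ*`, `θ* ≥ 0`.  If the A-corner hypothesis `Σ gp + Σ gn > 0` holds, then the θ-weighted (C-corner) sum satisfies
`Σ θp_i gp_i + Σ θn_k gn_k ≥ −Σ (θ* − θp_i)⁺ gp_i`: only upward jumps of `θ = a/γ` from a positive to a later negative class can cost.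
[cite: KozmaNitzan2024, Question 8 (§5.5 p. 36)] -/
theorem dR_chebyshev_CK (m n : ℕ) (gp θp gn θn : ℕ → ℝ) (θs : ℝ) (hθs : 0 ≤ θs)
    (hp : ∀ i < m, 0 ≤ gp i) (hn : ∀ k < n, gn k ≤ 0 ∧ θn k ≤ θs)
    (hyp : 0 < ∑ i ∈ range m, gp i + ∑ k ∈ range n, gn k) :
    -(∑ i ∈ range m, max (θs - θp i) 0 * gp i) ≤ ∑ i ∈ range m, θp i * gp i + ∑ k ∈ range n, θn k * gn k := by
  -- negatives: θn_k gn_k ≥ θ* gn_k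
  have h1 : θs * ∑ k ∈ range n, gn k ≤ ∑ k ∈ range n, θn k * gn k := by
    rw [mul_sum]; apply sum_le_sum; intro k hk
    have := hn k (mem_range.mp hk)
    exact mul_le_mul_of_nonpos_right this.2 this.1
  -- positives: θp_i gp_i ≥ θ* gp_i − (θ* − θp_i)⁺ gp_i
  have h2 : ∑ i ∈ range m, (θs * gp i - max (θs - θp i) 0 * gp i) ≤ ∑ i ∈ range m, θp i * gp i := by
    apply sum_le_sum; intro i hi
    have hg := hp i (mem_range.mp hi)
    have : (θs - θp i) * gp i ≤ max (θs - θp i) 0 * gp i := mul_le_mul_of_nonneg_right (le_max_left _ _) hg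
    nlinarith
  have h3 : ∑ i ∈ range m, (θs * gp i - max (θs - θp i) 0 * gp i)
      = θs * ∑ i ∈ range m, gp i - ∑ i ∈ range m, max (θs - θp i) 0 * gp i := by
    rw [sum_sub_distrib, mul_sum]
  have h4 : 0 ≤ θs * (∑ i ∈ range m, gp i + ∑ k ∈ range n, gn k) := mul_nonneg hθs hyp.le
  nlinarith

end PocketCert

end Summit.CriticalPhenomena.PercolationContinuityZ3.Theorems
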